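import Literature.Topology.FourManifolds.HomotopySpheres
import Literature.Geometry.Symplectic.StandardEnd
import Literature.Geometry.Symplectic.JHolomorphicMap
import Literature.Geometry.Symplectic.GromovR4RelEnd
import Literature.Geometry.Manifold.OpenSubmanifoldMFDeriv
import Mathlib.Geometry.Manifold.Diffeomorph
import Mathlib.Geometry.Manifold.MFDeriv.Atlas

/-!
# Vocabulary of the line `Sketch` (idea `pencil-incompleteness`) for crux `WitnessCharge`
(item stmt-SmoothPoincare4-7824, route route-SmoothPoincare4-SullivanDual)

Route-posited objects of the line, landed once here so that the sub-stubs of the hard stub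
`stub_pencilOrRescale` (lead's skeleton `Cruxes/WitnessCharge/Lines/Sketch.lean`, card
`Lines/Sketch.md`) can be stated over ONE tree definition each:

* `Ycoord p x` — the COMPLEX FLAT COORDINATES of the end: `(y₀ + i y₁, y₂ + i y₃)` with
  `y = ι(e x − e p)` (`e = extChartAt (𝓡 4) p`, `ι = inversion`); on the punctured chart-ball where the
  crux's `J` is standard, `J` is multiplication by `i` in these coordinates;
* `IsPencilMember J u b` — a PENCIL MEMBER with intercept `b`: a proper, injective, immersed,
  non-constant `C^∞` `J`-holomorphic `u : ℂ → Σ∖p`, asymptotic at infinity, in its canonical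
  parametrisation, to the flat line `w = b` (`z(u ξ) − ξ → 0`, `w(u ξ) → b` as `ξ → ∞`) — Gromov's
  `J`-planes of the pencil through one point at infinity, WITHOUT compactifying the end;
* `interceptSet J` — the set `Ω ⊂ ℂ` of realised intercepts;
* `CompletePencilData S p J` — a global diffeomorphism `F : ℂ × ℂ ≃ₘ Σ∖p` conjugating `J` to a
  continuous `Ĵ` with holomorphic slices `{b} × ℂ` and positively oriented transverse part (the
  first branch of `stub_pencilOrRescale`, the hypothesis of `stub_pencilExactTaming`);
* `CurveAway S p J` — a non-constant `C^∞` entire `J`-curve whose image avoids some punctured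
  chart-ball `B_η` (the second branch of `stub_pencilOrRescale`, the hypothesis of
  `stub_bubbleConfinement`).

Non-vacuity certificate (second half of the file, registered sub-goal `substub_farFlat` of the crux):
for `0 < ε'`, `closedBall (e p) ε' ⊆ e.target` and `‖b‖ > ε'⁻¹`, the FAR FLAT LINE
`ξ ↦ e⁻¹(e p + ι(realify (ξ, b)))` is a `C^∞` injective map `ℂ → Σ∖p` into the punctured `ε'`-ball
with `Ycoord = (ξ, b)` EXACTLY (realification `realify : ℂ × ℂ → ℝ⁴`, the standard structure `J₀`
with `⟪J₀ a, c⟫ = ω₀(a, c)`, chart bookkeeping via the tree's `inversion` API). The companion file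
`SullivanDualWitnessChargeSubstubFar.lean` upgrades it to a pencil member (`IsPencilMember`) for `J`
standard on the ball, proving the sub-stub `substub_far : ∃ R₀, ∀ b, R₀ < ‖b‖ → b ∈ interceptSet J`.

Deliberately NOT here: the stub statements themselves, and any claim about pencils (openness of
`Ω`, frontier dichotomy, packaging) — those are the registered sub-stubs.
-/

noncomputable section

-- the prescribed namespace `Summit.<P>.<Sub>.…` duplicates `SmoothPoincare4` (P = Sub)
set_option linter.dupNamespace false

open scoped Manifold ContDiff Topology
open Set Filter Literature.Geometry.Symplectic Literature.Topology.FourManifolds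

namespace Summit.SmoothPoincare4.SmoothPoincare4.Theorems.WitnessCharge.PencilIncompleteness

variable {S : HomotopySphere 4}

/-- COMPLEX FLAT COORDINATES of the end at `p`: `Ycoord p x = (y₀ + i y₁, y₂ + i y₃)` where
`y = ι(e x − e p)`, `e = extChartAt (𝓡 4) p`, `ι = inversion`. Meaningful on the punctured
chart-balls `InPuncturedChartBall p ε x` (there `x ↦ y` is a diffeomorphism onto `{‖y‖ > 1/ε}` and the
crux's standard `J` reads as multiplication by `i`); junk elsewhere (value through the junk of
`extChartAt`/`inversion`). (Line `Sketch`, lead's card `Lines/Sketch.md`, notation paragraph.) -/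
def Ycoord (p : S.carrier) (x : punctured p) : ℂ × ℂ :=
  (⟨inversion (extChartAt (𝓡 4) p x.1 - extChartAt (𝓡 4) p p) 0,
    inversion (extChartAt (𝓡 4) p x.1 - extChartAt (𝓡 4) p p) 1⟩,
   ⟨inversion (extChartAt (𝓡 4) p x.1 - extChartAt (𝓡 4) p p) 2,
    inversion (extChartAt (𝓡 4) p x.1 - extChartAt (𝓡 4) p p) 3⟩)

/-- A PENCIL MEMBER with intercept `b` for the endomorphism field `J` on `Σ ∖ p`: an entire
`J`-curve `u : ℂ → Σ∖p` (`IsEntireJCurve`: `C^∞`, non-constant, `du ∘ i = J ∘ du`) which is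
injective, immersed (`du(ξ)` injective for every `ξ`), PROPER (preimages of compact sets are compact),
and asymptotic at infinity to the flat line of intercept `b` in the canonical parametrisation:
`(Ycoord p (u ξ)).1 − ξ → 0` and `(Ycoord p (u ξ)).2 → b` along `cocompact ℂ`. These are Gromov's
pencil planes through one point of the line at infinity (Gromov 1985 §2.4.A), written without the
end-compactification. (Line `Sketch`, `Lines/Sketch.md` (P4) and addendum.) -/
def IsPencilMember {p : S.carrier}
    (J : ∀ x : punctured p, TangentSpace (𝓡 4) x →L[ℝ] TangentSpace (𝓡 4) x)
    (u : ℂ → punctured p) (b : ℂ) : Prop :=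
  IsEntireJCurve (𝓡 4) J u ∧ Function.Injective u ∧
  (∀ ξ : ℂ, Function.Injective (mfderiv 𝓘(ℝ, ℂ) (𝓡 4) u ξ)) ∧
  (∀ K : Set (punctured p), IsCompact K → IsCompact (u ⁻¹' K)) ∧
  Tendsto (fun ξ : ℂ => (Ycoord p (u ξ)).1 - ξ) (cocompact ℂ) (𝓝 0) ∧
  Tendsto (fun ξ : ℂ => (Ycoord p (u ξ)).2) (cocompact ℂ) (𝓝 b)

/-- The INTERCEPT SET `Ω` of the pencil: intercepts `b` realised by some pencil member.
(Line `Sketch`, `Lines/Sketch.md` Definition paragraph.) -/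
def interceptSet {p : S.carrier}
    (J : ∀ x : punctured p, TangentSpace (𝓡 4) x →L[ℝ] TangentSpace (𝓡 4) x) : Set ℂ :=
  {b | ∃ u : ℂ → punctured p, IsPencilMember J u b}

/-- COMPLETE-PENCIL DATA: a global diffeomorphism `F : ℂ × ℂ ≃ₘ Σ∖p` and a CONTINUOUS family of
endomorphisms `Ĵ` of `ℂ × ℂ` with `dF ∘ Ĵ = J ∘ dF` (so `Ĵ = F^*J`), holomorphic slices
`Ĵ (0, ζ) = (0, i ζ)`, and positively oriented transverse part `dA(w, (Ĵ (w, 0)).1) > 0` for `w ≠ 0`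
(`dA(a, b) = a.re b.im − a.im b.re`). Verbatim the first branch of the registered stub
`stub_pencilOrRescale` and the hypotheses of `stub_pencilExactTaming`. (Line `Sketch`, `Lines/Sketch.md` (P6).) -/
def CompletePencilData (S : HomotopySphere 4) (p : S.carrier)
    (J : ∀ x : punctured p, TangentSpace (𝓡 4) x →L[ℝ] TangentSpace (𝓡 4) x) : Prop :=
  ∃ (F : (ℂ × ℂ) ≃ₘ⟮𝓘(ℝ, ℂ × ℂ), 𝓡 4⟯ (punctured p))
      (Jhat : ℂ × ℂ → (ℂ × ℂ →L[ℝ] ℂ × ℂ)), Continuous Jhat ∧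
    (∀ (q : ℂ × ℂ) (u : ℂ × ℂ),
      mfderiv 𝓘(ℝ, ℂ × ℂ) (𝓡 4) F q (Jhat q u) = J (F q) (mfderiv 𝓘(ℝ, ℂ × ℂ) (𝓡 4) F q u)) ∧
    (∀ (q : ℂ × ℂ) (ζ : ℂ), Jhat q (0, ζ) = (0, Complex.I * ζ)) ∧
    (∀ (q : ℂ × ℂ) (w : ℂ), w ≠ 0 →
      0 < w.re * ((Jhat q (w, 0)).1).im - w.im * ((Jhat q (w, 0)).1).re)

/-- A CURVE STAYING AWAY FROM `p`: a non-constant `C^∞` entire `J`-curve whose image avoids some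
punctured chart-ball `B_η`, `η > 0` (equivalently: has relatively compact image in `Σ ∖ p`).
Verbatim the second branch of `stub_pencilOrRescale` and the hypothesis shape of
`stub_bubbleConfinement`. (Line `Sketch`, `Lines/Sketch.md` (P5-B).) -/
def CurveAway (S : HomotopySphere 4) (p : S.carrier)
    (J : ∀ x : punctured p, TangentSpace (𝓡 4) x →L[ℝ] TangentSpace (𝓡 4) x) : Prop :=
  ∃ u : ℂ → punctured p, IsEntireJCurve (𝓡 4) J u ∧
    ∃ η : ℝ, 0 < η ∧ ∀ z : ℂ, ¬ InPuncturedChartBall p η (u z)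

/-! ### Unfolding lemmas -/

/-- Membership in the intercept set (definitional). -/
theorem mem_interceptSet_iff {p : S.carrier}
    {J : ∀ x : punctured p, TangentSpace (𝓡 4) x →L[ℝ] TangentSpace (𝓡 4) x} {b : ℂ} :
    b ∈ interceptSet J ↔ ∃ u : ℂ → punctured p, IsPencilMember J u b :=
  Iff.rfl

/-- A curve staying away from `p` avoids every smaller punctured chart-ball as well (monotonicity of
`InPuncturedChartBall` in the radius). -/
theorem CurveAway.mono_radius {p : S.carrier}
    {J : ∀ x : punctured p, TangentSpace (𝓡 4) x →L[ℝ] TangentSpace (𝓡 4) x}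
    (h : CurveAway S p J) {η' : ℝ} (hη' : 0 < η') :
    ∃ u : ℂ → punctured p, IsEntireJCurve (𝓡 4) J u ∧
      ∃ η : ℝ, 0 < η ∧ η ≤ η' ∧ ∀ z : ℂ, ¬ InPuncturedChartBall p η (u z) := by
  obtain ⟨u, hu, η, hη, hav⟩ := h
  refine ⟨u, hu, min η η', lt_min hη hη', min_le_right _ _, fun z hz => hav z ?_⟩
  exact ⟨hz.1, Metric.ball_subset_ball (min_le_left _ _) hz.2⟩

/-! ## Non-vacuity of the vocabulary: the far flat lines (registered sub-goal `substub_farFlat`) -/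

/-! ### Flat preliminaries: realification `ℂ × ℂ → ℝ⁴` and the standard structure `J₀` -/

/-- Local notation for the model space `ℝ⁴`. -/
local notation "E4" => EuclideanSpace ℝ (Fin 4)

/-- Realification `(z, w) ↦ (Re z, Im z, Re w, Im w)`, inverse to the coordinates of `Ycoord`. -/
def realify (q : ℂ × ℂ) : E4 := WithLp.toLp 2 ![q.1.re, q.1.im, q.2.re, q.2.im]

/-- Component `0` of `realify`. -/
@[simp] theorem realify_apply_zero (q : ℂ × ℂ) : realify q 0 = q.1.re := rfl
/-- Component `1` of `realify`. -/
@[simp] theorem realify_apply_one (q : ℂ × ℂ) : realify q 1 = q.1.im := rfl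
/-- Component `2` of `realify`. -/
@[simp] theorem realify_apply_two (q : ℂ × ℂ) : realify q 2 = q.2.re := rfl
/-- Component `3` of `realify`. -/
@[simp] theorem realify_apply_three (q : ℂ × ℂ) : realify q 3 = q.2.im := rfl

/-- `realify` as a continuous `ℝ`-linear map. -/
def realifyL : ℂ × ℂ →L[ℝ] E4 :=
  LinearMap.toContinuousLinearMap
    { toFun := realify
      map_add' := fun a b => by
        ext i; fin_cases i <;> simp [realify]
      map_smul' := fun c a => by
        ext i; fin_cases i <;> simp [realify] }

/-- `realifyL` is `realify`. -/
@[simp] theorem realifyL_apply (q : ℂ × ℂ) : realifyL q = realify q := rfl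

/-- `‖realify (z, w)‖² = ‖z‖² + ‖w‖²`. -/
theorem norm_realify_sq (q : ℂ × ℂ) : ‖realify q‖ ^ 2 = ‖q.1‖ ^ 2 + ‖q.2‖ ^ 2 := by
  rw [EuclideanSpace.norm_sq_eq, Fin.sum_univ_four]
  simp only [realify_apply_zero, realify_apply_one, realify_apply_two, realify_apply_three,
    Real.norm_eq_abs, sq_abs, Complex.sq_norm, Complex.normSq_apply]
  ring

/-- `realify` is injective. -/
theorem realify_injective : Function.Injective realify := by
  intro a b h
  have h0 := congrArg (fun v : E4 => v 0) h
  have h1 := congrArg (fun v : E4 => v 1) h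
  have h2 := congrArg (fun v : E4 => v 2) h
  have h3 := congrArg (fun v : E4 => v 3) h
  simp only [realify_apply_zero, realify_apply_one, realify_apply_two, realify_apply_three] at h0 h1 h2 h3
  exact Prod.ext (Complex.ext h0 h1) (Complex.ext h2 h3)

/-- The standard complex structure of `ℝ⁴` in the crux's normalisation: `J₀ a = (−a₁, a₀, −a₃, a₂)`,
so that `⟪J₀ a, c⟫ = ω₀(a, c)`. -/
def J0 (a : E4) : E4 := WithLp.toLp 2 ![-(a 1), a 0, -(a 3), a 2]

/-- Component `0` of `J₀ a`. -/
@[simp] theorem J0_apply_zero (a : E4) : J0 a 0 = -(a 1) := rfl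
/-- Component `1` of `J₀ a`. -/
@[simp] theorem J0_apply_one (a : E4) : J0 a 1 = a 0 := rfl
/-- Component `2` of `J₀ a`. -/
@[simp] theorem J0_apply_two (a : E4) : J0 a 2 = -(a 3) := rfl
/-- Component `3` of `J₀ a`. -/
@[simp] theorem J0_apply_three (a : E4) : J0 a 3 = a 2 := rfl

/-- `⟪J₀ a, c⟫ = ω₀(a, c)`. -/
theorem inner_J0 (a c : E4) : inner ℝ (J0 a) c = stdSymplecticForm a c := by
  rw [EuclideanSpace.inner_eq_star_dotProduct, dotProduct, Fin.sum_univ_four]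
  simp [stdSymplecticForm]
  ring

/-- `realify` intertwines multiplication by `i` in the first factor with `J₀` (on vectors
with zero second component). -/
theorem realify_I_mul (ζ : ℂ) : realify (Complex.I * ζ, 0) = J0 (realify (ζ, 0)) := by
  ext i; fin_cases i <;> simp [realify, J0]

/-- A vector of `ℝ⁴` is determined by its inner products. -/
theorem eq_of_inner_eq {a a' : E4} (h : ∀ c : E4, inner ℝ a c = inner ℝ a' c) : a = a' := by
  have : inner ℝ (a - a') (a - a') = (0 : ℝ) := by
    rw [inner_sub_left, h (a - a'), sub_self]
  exact sub_eq_zero.1 (inner_self_eq_zero.1 this)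


/-! ### The far flat line of intercept `b`: `ξ ↦ e⁻¹(e p + ι(realify (ξ, b)))` -/

section FarLine

variable (p : S.carrier)

/-- The point of `Σ` with flat coordinates `(ξ, b)`: `e.symm (e p + ι (realify (ξ, b)))`. -/
def farPt (b ξ : ℂ) : S.carrier :=
  (extChartAt (𝓡 4) p).symm (extChartAt (𝓡 4) p p + inversion (realify (ξ, b)))

variable {p} {ε' : ℝ} {b : ℂ}

/-- For `‖b‖ > ε'⁻¹ > 0`: `realify (ξ, b) ≠ 0`. -/
theorem realify_ne_zero (hε' : 0 < ε') (hb : ε'⁻¹ < ‖b‖) (ξ : ℂ) : realify (ξ, b) ≠ 0 := by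
  intro h
  have hb0 : b ≠ 0 := by
    rintro rfl
    rw [norm_zero] at hb
    exact lt_irrefl _ (hb.trans (inv_pos.2 hε'))
  have h2 := congrArg (fun v : E4 => v 2) h
  have h3 := congrArg (fun v : E4 => v 3) h
  simp only [realify_apply_two, realify_apply_three, PiLp.zero_apply] at h2 h3
  exact hb0 (Complex.ext h2 h3)

/-- `‖b‖ ≤ ‖realify (ξ, b)‖`. -/
theorem norm_le_norm_realify (ξ b : ℂ) : ‖b‖ ≤ ‖realify (ξ, b)‖ := by
  have h := norm_realify_sq (ξ, b)
  simp only at h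
  nlinarith [norm_nonneg b, norm_nonneg (realify (ξ, b)), norm_nonneg ξ, sq_nonneg ‖ξ‖]

/-- For `‖b‖ > ε'⁻¹ > 0`: `‖ι (realify (ξ, b))‖ < ε'`. -/
theorem norm_inversion_realify_lt (hε' : 0 < ε') (hb : ε'⁻¹ < ‖b‖) (ξ : ℂ) :
    ‖inversion (realify (ξ, b))‖ < ε' := by
  rw [norm_inversion]
  have hbpos : 0 < ‖b‖ := (inv_pos.2 hε').trans hb
  have h1 : ‖realify (ξ, b)‖⁻¹ ≤ ‖b‖⁻¹ :=
    inv_anti₀ hbpos (norm_le_norm_realify ξ b)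
  have h2 : ‖b‖⁻¹ < ε' := (inv_lt_comm₀ hbpos hε').2 hb
  exact h1.trans_lt h2

variable (hε' : 0 < ε')
  (hball : Metric.closedBall (extChartAt (𝓡 4) p p) ε' ⊆ (extChartAt (𝓡 4) p).target)
  (hb : ε'⁻¹ < ‖b‖)
include hε' hball hb

/-- The chart value of the far point lies in the chart target. -/
theorem farPt_mem_target (ξ : ℂ) :
    extChartAt (𝓡 4) p p + inversion (realify (ξ, b)) ∈ (extChartAt (𝓡 4) p).target := by
  apply hball
  rw [Metric.mem_closedBall, dist_eq_norm, add_sub_cancel_left]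
  exact (norm_inversion_realify_lt hε' hb ξ).le

/-- The far point lies in the chart source at `p`. -/
theorem farPt_mem_source (ξ : ℂ) : farPt p b ξ ∈ (chartAt (EuclideanSpace ℝ (Fin 4)) p).source := by
  rw [← extChartAt_source (I := 𝓡 4)]
  exact (extChartAt (𝓡 4) p).map_target (farPt_mem_target hε' hball hb ξ)

/-- The chart reads the far point as `e p + ι(realify (ξ, b))`. -/
theorem extChartAt_farPt (ξ : ℂ) :
    extChartAt (𝓡 4) p (farPt p b ξ) = extChartAt (𝓡 4) p p + inversion (realify (ξ, b)) :=
  (extChartAt (𝓡 4) p).right_inv (farPt_mem_target hε' hball hb ξ)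

/-- The far point is not `p`. -/
theorem farPt_ne (ξ : ℂ) : farPt p b ξ ≠ p := by
  intro h
  have h1 := extChartAt_farPt hε' hball hb ξ
  rw [h, left_eq_add] at h1
  exact inversion_ne_zero (realify_ne_zero hε' hb ξ) h1

/-- The far line as a map into `Σ ∖ p`. -/
def farLine (ξ : ℂ) : punctured p :=
  ⟨farPt p b ξ, mem_punctured.2 (farPt_ne hε' hball hb ξ)⟩

/-- The far line lies in the punctured `ε'`-chart-ball. -/
theorem farLine_mem_ball (ξ : ℂ) : InPuncturedChartBall p ε' (farLine hε' hball hb ξ) := by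
  refine ⟨farPt_mem_source hε' hball hb ξ, ?_⟩
  show extChartAt (𝓡 4) p (farPt p b ξ) ∈ Metric.ball (extChartAt (𝓡 4) p p) ε'
  rw [extChartAt_farPt hε' hball hb ξ, Metric.mem_ball, dist_eq_norm, add_sub_cancel_left]
  exact norm_inversion_realify_lt hε' hb ξ

/-- The flat coordinate `y = ι(e x − e p)` of the far-line point is `realify (ξ, b)`. -/
theorem inversion_farLine (ξ : ℂ) :
    inversion (extChartAt (𝓡 4) p (farLine hε' hball hb ξ).1 - extChartAt (𝓡 4) p p) =
      realify (ξ, b) := by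
  show inversion (extChartAt (𝓡 4) p (farPt p b ξ) - extChartAt (𝓡 4) p p) = realify (ξ, b)
  rw [extChartAt_farPt hε' hball hb ξ, add_sub_cancel_left, inversion_inversion]

/-- The complex flat coordinates of the far-line point are `(ξ, b)`. -/
theorem Ycoord_farLine (ξ : ℂ) : Ycoord p (farLine hε' hball hb ξ) = (ξ, b) := by
  simp only [Ycoord, inversion_farLine hε' hball hb ξ, realify_apply_zero, realify_apply_one,
    realify_apply_two, realify_apply_three, Complex.eta]

/-- The far line is injective. -/
theorem farLine_injective : Function.Injective (farLine hε' hball hb) := by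
  intro ξ ξ' h
  have := congrArg (fun x => (Ycoord p x).1) h
  simpa only [Ycoord_farLine] using this


/-! #### Smoothness of the far line -/

omit hball in
/-- The flat map `ξ ↦ e p + ι(realify (ξ, b))` is `C^∞`. -/
theorem contDiff_farChart :
    ContDiff ℝ ∞ (fun ξ : ℂ => extChartAt (𝓡 4) p p + inversion (realify (ξ, b))) := by
  rw [contDiff_iff_contDiffAt]
  intro ξ
  refine contDiffAt_const.add ?_
  have h1 : ContDiffAt ℝ ∞ inversion (realify (ξ, b)) :=
    contDiffAt_inversion (realify_ne_zero hε' hb ξ)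
  have h2 : ContDiff ℝ ∞ (fun ξ : ℂ => realify (ξ, b)) := by
    have : (fun ξ : ℂ => realify (ξ, b)) = fun ξ => realifyL ((ContinuousLinearMap.inl ℝ ℂ ℂ) ξ + (0, b)) := by
      funext ξ; simp
    rw [this]
    exact realifyL.contDiff.comp ((ContinuousLinearMap.inl ℝ ℂ ℂ).contDiff.add contDiff_const)
  exact ContDiffAt.comp (g := inversion) (f := fun ξ : ℂ => realify (ξ, b)) ξ h1 h2.contDiffAt

/-- The far line is `C^∞` as a map into `Σ`. -/
theorem contMDiff_val_farLine :
    ContMDiff 𝓘(ℝ, ℂ) (𝓡 4) ∞ (Subtype.val ∘ farLine hε' hball hb) := by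
  have h1 : ContMDiffOn 𝓘(ℝ, ℂ) 𝓘(ℝ, EuclideanSpace ℝ (Fin 4)) ∞
      (fun ξ : ℂ => extChartAt (𝓡 4) p p + inversion (realify (ξ, b))) univ :=
    (contDiff_farChart hε' hb).contMDiff.contMDiffOn
  have h2 := (contMDiffOn_extChartAt_symm (I := 𝓡 4) (n := ∞) p).comp h1
    (fun ξ _ => farPt_mem_target hε' hball hb ξ)
  exact contMDiffOn_univ.1 h2

/-- The far line is `C^∞` as a map into `Σ ∖ p`. -/
theorem contMDiff_farLine : ContMDiff 𝓘(ℝ, ℂ) (𝓡 4) ∞ (farLine hε' hball hb) :=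
  (ContMDiff.subtypeVal_comp_iff (punctured p) _).1 (contMDiff_val_farLine hε' hball hb)


end FarLine

/-- **Registered sub-goal `substub_farFlat`** (part 1 of `substub_far`): for `0 < ε'`, closed
`ε'`-ball inside the chart target and `‖b‖ > ε'⁻¹`, there is a `C^∞` injective `u : ℂ → Σ∖p` into
the punctured `ε'`-chart-ball with complex flat coordinates exactly `(ξ, b)` — the far flat line. -/
theorem substub_farFlat :
    ∀ (S : HomotopySphere 4) (p : S.carrier) (ε' : ℝ) (b : ℂ),
      0 < ε' →
      Metric.closedBall (extChartAt (𝓡 4) p p) ε' ⊆ (extChartAt (𝓡 4) p).target →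
      ε'⁻¹ < ‖b‖ →
      ∃ u : ℂ → punctured p, ContMDiff 𝓘(ℝ, ℂ) (𝓡 4) ∞ u ∧ Function.Injective u ∧
        ∀ ξ : ℂ, InPuncturedChartBall p ε' (u ξ) ∧ Ycoord p (u ξ) = (ξ, b) := by
  intro S p ε' b hε' hball hb
  exact ⟨farLine hε' hball hb, contMDiff_farLine hε' hball hb, farLine_injective hε' hball hb,
    fun ξ => ⟨farLine_mem_ball hε' hball hb ξ, Ycoord_farLine hε' hball hb ξ⟩⟩


end Summit.SmoothPoincare4.SmoothPoincare4.Theorems.WitnessCharge.PencilIncompleteness
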